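import Mathlib
import HarnessLib
import Summits.HubbardSuperconductivity.HubbardSuperconductivity.Theorems.ChiralWindowCwKLChiralWindowChannelOps
import Summits.HubbardSuperconductivity.HubbardSuperconductivity.Theorems.WeakCouplingBCSWcbcsKohnLuttingerB1gKlCertFormD
import Summits.HubbardSuperconductivity.HubbardSuperconductivity.Theorems.WeakCouplingBCSDefsKlCertTPrime
import Summits.HubbardSuperconductivity.HubbardSuperconductivity.Theorems.WeakCouplingBCSKlCertTPrimeD4Invariant
import Summits.HubbardSuperconductivity.HubbardSuperconductivity.Theorems.WeakCouplingBCSKlCertTPrimeHausdorffFinite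
import Summits.HubbardSuperconductivity.HubbardSuperconductivity.Theorems.WeakCouplingBCSKlCertTPrimeLeafReductions
import Summits.HubbardSuperconductivity.HubbardSuperconductivity.Theorems.WeakCouplingBCSKlCertTPrimeLindhardD4

/-!
# «(KLSCAN)-TPRIME-SOUNDNESS» (1/5): the bundled analytic hypothesis `KLTPAnalytic ε μ` and the generic channel operator package

Cell `gate-hubbard-kl`, seat p3 (g20); located item «(KLSCAN)-TPRIME-SOUNDNESS» (pen (R269)(D)/(R279); director INBOX l.284 KL-MARGIN-SCAN (α)).
HYPOTHESIS STYLE: the t′ = 0 soundness chain behind `klb1gd_window(_U)` (`…ChannelOps` → `…BottomStates` → `…ChannelBound` → `…ChannelFar` →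
`…BlockBounds` → `…KlCertFormD`) re-keyed VERBATIM at an arbitrary dispersion `ε` / at `squareDispersion 1 tp`, with the five analytic leaves
(finite Fermi-curve measure, `D₄` measure preservation, Hilbert–Schmidt Lindhard kernel, `D₄`-invariance of `χ₀`, channel-state existence) carried
as ONE hypothesis `KLTPAnalytic ε μ` instead of the registered `stub_kl*` leaves (which prove them at `t′ = 0`, `μ ∈ (−4,0)`: `klTPAnalytic_zero`).
Nothing here asserts a certificate at any `t′ ≠ 0`, the margin, the window or superconductivity.  `--supports stmt-HubbardSuperconductivity-0158` (helper).
References: M. Reed, B. Simon, *Methods of Modern Mathematical Physics* I Thm. VI.16/VI.23, IV Thm. XIII.5; S. Raghu, S. A. Kivelson, D. J. Scalapino,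
Phys. Rev. B 81 (2010) 224505, §II–§III.
This file: `KLTPAnalytic` (def) + `klTPAnalytic_zero` + `klTPAnalytic_of` (the two `D₄` leaves are theorems at every `t′`: p4 g19's
`klph_d4_measurePreserving`, p4's `klph_lindhardD4`); `kltp_d4Unitary`, `kltp_sectorProj`, `kltp_baseKernel_invariant/_memLp`,
`kltp_channelOps` (generic twins of `stub_klD4Unitary/SectorProj/ChannelOps`), `kltp_frameHS` (twin of `stub_klFrameHS`).
-/

noncomputable section

set_option linter.dupNamespace false

namespace Summit.HubbardSuperconductivity.HubbardSuperconductivity.Theorems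

open MeasureTheory Literature.MathematicalPhysics.QuantumLattice Literature.Analysis.OperatorTheory CwKLChiralWindow
open Summit.HubbardSuperconductivity.HubbardSuperconductivity.Theorems.CwKLChiralWindow.Negative
open scoped InnerProductSpace Pointwise

/-! ## The analytic hypotheses of a `(ε, μ)` cell, bundled -/

/-- **The analytic facts of the certificate soundness chain at the dispersion `ε` and level `μ`**, as ONE hypothesis: the Fermi-curve
measure `σ = fermiCurveMeasure ε μ` is finite, `D₄` acts on it by measure-preserving maps, the Lindhard kernel `χ₀_ε(k + k′)` is in `L²(σ⊗σ)`,
`χ₀_ε` is `D₄`-invariant, and every channel has a state.  At `ε = squareDispersion 1 0`, `μ ∈ (−4, 0)` these are the tree's `stub_klFiniteMeasure`, `stub_klD4Invariant`,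
`stub_klKernelHS`, `stub_klLindhardD4` (`klTPAnalytic_zero`). [folklore] -/
def KLTPAnalytic (ε : Momentum → ℝ) (μ : ℝ) : Prop :=
  IsFiniteMeasure (fermiCurveMeasure ε μ) ∧
  (∀ g : DihedralGroup 4, MeasurePreserving (d4Momentum g) (fermiCurveMeasure ε μ) (fermiCurveMeasure ε μ)) ∧
  MemLp (fun z : Momentum × Momentum => lindhardFunction ε μ (z.1 + z.2)) 2 ((fermiCurveMeasure ε μ).prod (fermiCurveMeasure ε μ)) ∧
  (∀ (g : DihedralGroup 4) (q : Momentum), lindhardFunction ε μ (d4Momentum g q) = lindhardFunction ε μ q) ∧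
  (∀ χ : D4Irrep, {ψ | IsChannelState ε μ χ ψ}.Nonempty)

/-- **At `t′ = 0` the bundled hypotheses are the tree's analytic stubs** (`μ ∈ (−4, 0)`). [folklore] -/
theorem klTPAnalytic_zero {μ : ℝ} (hμ : μ ∈ Set.Ioo (-4 : ℝ) 0) : KLTPAnalytic (squareDispersion 1 0) μ :=
  ⟨stub_klFiniteMeasure stub_klGradient stub_klHausdorffFinite μ hμ, stub_klD4Invariant stub_klGradient μ hμ,
    stub_klKernelHS μ hμ, fun g q => stub_klLindhardD4 μ g q, fun χ => nonempty_isChannelState hμ.1 hμ.2 χ⟩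

/-! ## Two of the five leaves are UNCONDITIONAL at every `t′` -/

/-- **`KLTPAnalytic` at `squareDispersion 1 tp` from the THREE remaining leaves** — finiteness of `σ`, the Hilbert–Schmidt property of
`χ₀_{t′}(·+·)`, and channel-state existence — the `D₄` rows being theorems (p4 g19's `klph_d4_measurePreserving`, `kltp_lindhardD4`). [folklore] -/
theorem klTPAnalytic_of (tp μ : ℝ) (hfin : IsFiniteMeasure (fermiCurveMeasure (squareDispersion 1 tp) μ))
    (hHS : MemLp (fun z : Momentum × Momentum => lindhardFunction (squareDispersion 1 tp) μ (z.1 + z.2)) 2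
      ((fermiCurveMeasure (squareDispersion 1 tp) μ).prod (fermiCurveMeasure (squareDispersion 1 tp) μ)))
    (hne : ∀ χ : D4Irrep, {ψ | IsChannelState (squareDispersion 1 tp) μ χ ψ}.Nonempty) :
    KLTPAnalytic (squareDispersion 1 tp) μ :=
  ⟨hfin, klph_d4_measurePreserving tp μ, hHS, fun g q => klph_lindhardD4 tp μ g q, hne⟩



/-- **`KLTPAnalytic` at `(squareDispersion 1 tp, μ)` from THREE CERTIFIED NUMBERS** (pen (R286): the analytic side of a t′ record): a speed-square
floor `w > 0` on the Fermi curve (off the van Hove strip; finiteness by p4 g19's `klph_isFiniteMeasure_tp_of_speedSqFloor'`, finite length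
unconditional p673407), a sup `C` of `|χ₀_{t′}(k + k′)|` on `F × F` (Hilbert–Schmidt by `klph_memLp_kernel_of_bound`), and for every channel one in-channel
`L²` function of positive norm (e.g. the record's trial, `klph_channelStates_nonempty_of_pos`); the `D₄` rows are theorems. [folklore] -/
theorem klTPAnalytic_of_numbers (tp μ : ℝ) {w : ℝ} (hw : 0 < w)
    (hspeed : ∀ k ∈ fermiCurve (squareDispersion 1 tp) μ,
      w ≤ (2 * Real.sin (k 0) * (1 + 2 * tp * Real.cos (k 1))) ^ 2 + (2 * Real.sin (k 1) * (1 + 2 * tp * Real.cos (k 0))) ^ 2)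
    {C : ℝ} (hC : ∀ k ∈ fermiCurve (squareDispersion 1 tp) μ, ∀ k' ∈ fermiCurve (squareDispersion 1 tp) μ,
      |lindhardFunction (squareDispersion 1 tp) μ (k + k')| ≤ C)
    (φ : D4Irrep → Momentum → ℝ) (hφmem : ∀ χ, MemLp (φ χ) 2 (fermiCurveMeasure (squareDispersion 1 tp) μ))
    (hφch : ∀ χ, InChannel χ (φ χ)) (hφpos : ∀ χ, 0 < ∫ k, φ χ k ^ 2 ∂fermiCurveMeasure (squareDispersion 1 tp) μ) :
    KLTPAnalytic (squareDispersion 1 tp) μ := by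
  haveI := klph_isFiniteMeasure_tp_of_speedSqFloor' tp μ hw hspeed
  exact klTPAnalytic_of tp μ ‹_› (klph_memLp_kernel_of_bound (measurable_squareDispersion 1 tp) μ hC)
    (fun χ => klph_channelStates_nonempty_of_pos (hφmem χ) (hφch χ) (hφpos χ))

/-- generic `stub_klD4Unitary`. [folklore] -/
theorem kltp_d4Unitary (ε : Momentum → ℝ) (μ : ℝ)
    (hT : ∀ g : DihedralGroup 4, MeasurePreserving (d4Momentum g) (fermiCurveMeasure ε μ) (fermiCurveMeasure ε μ)) :
    ∃ U : DihedralGroup 4 →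
        (Lp ℝ 2 (fermiCurveMeasure ε μ) →L[ℝ] Lp ℝ 2 (fermiCurveMeasure ε μ)),
      (∀ (g : DihedralGroup 4) (φ : Lp ℝ 2 (fermiCurveMeasure ε μ)),
        (U g φ : Momentum → ℝ) =ᵐ[fermiCurveMeasure ε μ] fun k => φ (d4Momentum g k)) ∧
      (∀ (g : DihedralGroup 4) (ψ : Momentum → ℝ), MemLp ψ 2 (fermiCurveMeasure ε μ) →
        MemLp (fun k => ψ (d4Momentum g k)) 2 (fermiCurveMeasure ε μ)) ∧
      U 1 = 1 ∧
      (∀ g h : DihedralGroup 4, U g * U h = U (h * g)) ∧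
      (∀ (g : DihedralGroup 4) (φ ψ : Lp ℝ 2 (fermiCurveMeasure ε μ)),
        inner ℝ (U g φ) (U g ψ) = inner ℝ φ ψ) ∧
      (∀ (g : DihedralGroup 4) (φ ψ : Lp ℝ 2 (fermiCurveMeasure ε μ)),
        inner ℝ (U g φ) ψ = inner ℝ φ (U g⁻¹ ψ)) ∧
      (∀ (K : Momentum → Momentum → ℝ)
        (A : Lp ℝ 2 (fermiCurveMeasure ε μ) →L[ℝ] Lp ℝ 2 (fermiCurveMeasure ε μ)),
        (∀ (g : DihedralGroup 4) (k k' : Momentum), K (d4Momentum g k) (d4Momentum g k') = K k k') →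
        MemLp (Function.uncurry K) 2
          ((fermiCurveMeasure ε μ).prod (fermiCurveMeasure ε μ)) →
        (∀ φ : Lp ℝ 2 (fermiCurveMeasure ε μ),
          (A φ : Momentum → ℝ) =ᵐ[fermiCurveMeasure ε μ]
            fun k => ∫ k', K k k' * φ k' ∂fermiCurveMeasure ε μ) →
        ∀ g : DihedralGroup 4, A * U g = U g * A) := by
  obtain ⟨U, hae, h1, hprod, hinner, hadj, hcomm⟩ :=
    kl_du_exists_ops hT kl_du_d4Momentum_mul d4Momentum_one
  exact ⟨U, hae, fun g ψ hψ => hψ.comp_measurePreserving (hT g), h1, hprod, hinner, hadj,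
    fun K A hK _ hA g => hcomm K A hK hA g⟩


/-- generic `stub_klSectorProj`. [folklore] -/
theorem kltp_sectorProj (ε : Momentum → ℝ) (μ : ℝ)
    (hmp : ∀ γ : DihedralGroup 4, MeasurePreserving (d4Momentum γ) (fermiCurveMeasure ε μ) (fermiCurveMeasure ε μ)) :
    ∀ U : DihedralGroup 4 →
        (Lp ℝ 2 (fermiCurveMeasure ε μ) →L[ℝ] Lp ℝ 2 (fermiCurveMeasure ε μ)),
      (∀ (g : DihedralGroup 4) (φ : Lp ℝ 2 (fermiCurveMeasure ε μ)),
        (U g φ : Momentum → ℝ) =ᵐ[fermiCurveMeasure ε μ] fun k => φ (d4Momentum g k)) →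
      U 1 = 1 → (∀ g h : DihedralGroup 4, U g * U h = U (h * g)) →
      (∀ (g : DihedralGroup 4) (φ ψ : Lp ℝ 2 (fermiCurveMeasure ε μ)),
        inner ℝ (U g φ) ψ = inner ℝ φ (U g⁻¹ ψ)) →
      ∀ χ : D4Irrep,
        ∃ P : Lp ℝ 2 (fermiCurveMeasure ε μ) →L[ℝ] Lp ℝ 2 (fermiCurveMeasure ε μ),
          P = (χ.dim / 8 : ℝ) • ∑ g : DihedralGroup 4, χ.char g • U g ∧
          (∀ φ : Lp ℝ 2 (fermiCurveMeasure ε μ),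
            (P φ : Momentum → ℝ) =ᵐ[fermiCurveMeasure ε μ] fun k => d4Project χ φ k) ∧
          P * P = P ∧ IsSelfAdjoint P ∧
          (∀ g : DihedralGroup 4, U g * P = P * U g) ∧
          (∀ (ψ : Momentum → ℝ) (hψ : MemLp ψ 2 (fermiCurveMeasure ε μ)),
            InChannel χ ψ → P (hψ.toLp ψ) = hψ.toLp ψ) ∧
          (∀ φ : Lp ℝ 2 (fermiCurveMeasure ε μ), P φ = φ →
            ∃ ψ : Momentum → ℝ, InChannel χ ψ ∧ MemLp ψ 2 (fermiCurveMeasure ε μ) ∧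
              (φ : Momentum → ℝ) =ᵐ[fermiCurveMeasure ε μ] ψ) ∧
          (χ = D4Irrep.E → P = (1 / 2 : ℝ) • (1 - U (DihedralGroup.r 2))) := by
  intro U hU hU1 hUmul hUadj χ
  refine ⟨(χ.dim / 8 : ℝ) • ∑ g : DihedralGroup 4, χ.char g • U g, rfl, kl_sp_ae_formula U hU χ,
    kl_sp_proj_mul_proj U hUmul χ, ?_, fun g => kl_sp_comm_proj U hUmul χ g,
    kl_sp_proj_toLp hmp U hU χ, ?_, ?_⟩
  · -- self-adjointness: `U_g* = U_{g⁻¹}`, reindex `g ↦ g⁻¹`, `χ(g⁻¹) = χ(g)`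
    rw [ContinuousLinearMap.isSelfAdjoint_iff_isSymmetric]
    intro x y
    simp only [ContinuousLinearMap.coe_coe, smul_apply, sum_apply, real_inner_smul_left,
      real_inner_smul_right, sum_inner, inner_sum]
    congr 1
    simp_rw [hUadj]
    exact Fintype.sum_equiv (Equiv.inv _) _ _ fun g => by
      simp only [Equiv.inv_apply, kl_sp_char_inv]
  · -- fixed points have channel representatives
    intro φ hφ
    refine ⟨d4Project χ φ, kl_sp_inChannel_d4Project χ φ, kl_sp_memLp_d4Project hmp χ φ, ?_⟩
    have h1 := kl_sp_ae_formula U hU χ φ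
    rw [hφ] at h1
    exact h1
  · -- the `E` projector is the odd part
    intro hχ
    subst hχ
    rw [kl_sp_sum_d4]
    simp only [D4Irrep.char, D4Irrep.dim, ne10, ne12, ne20, ne30, ne32, if_true, if_false, zero_smul,
      add_zero, DihedralGroup.r_zero, hU1, Nat.cast_ofNat]
    module


/-- The base kernel `c + χ₀(k + q)` is `D₄`-invariant in both variables jointly. [folklore] -/
theorem kltp_baseKernel_invariant (ε : Momentum → ℝ) (μ : ℝ)
    (hLD4 : ∀ (g : DihedralGroup 4) (q : Momentum), lindhardFunction ε μ (d4Momentum g q) = lindhardFunction ε μ q)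
    (c : ℝ) (g : DihedralGroup 4) (k q : Momentum) :
    c + lindhardFunction ε μ (d4Momentum g k + d4Momentum g q) =
      c + lindhardFunction ε μ (k + q) := by
  rw [← kl_co_d4Momentum_add, hLD4]

/-- The base kernel `(k, q) ↦ c + χ₀(k + q)` is square integrable on `σ_μ ⊗ σ_μ` for `μ ∈ (-4,0)`. [folklore] -/
theorem kltp_baseKernel_memLp (ε : Momentum → ℝ) (μ : ℝ) [IsFiniteMeasure (fermiCurveMeasure ε μ)]
    (hχHS : MemLp (fun z : Momentum × Momentum => lindhardFunction ε μ (z.1 + z.2)) 2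
      ((fermiCurveMeasure ε μ).prod (fermiCurveMeasure ε μ))) (c : ℝ) :
    MemLp (Function.uncurry fun k q : Momentum => c + lindhardFunction ε μ (k + q)) 2
      ((fermiCurveMeasure ε μ).prod (fermiCurveMeasure ε μ)) := by
  exact (memLp_const c).add hχHS

/-- **The operator package of a symmetry channel** (`stub_klChannelOps`). For `μ ∈ (-4,0)`, a channel `χ`, a flag `withU`
(allowed only for `A1g`) and an admissible deflation `(c_m ≥ 0, u_m ∈ L²(σ_μ))`: there are bounded operators `A`, `P`,
`U₁` on `L²(σ_μ)` such that `A` acts a.e. by the base kernel `κ(k,q) = [withU] + χ₀(k+q)` (with the matrix-element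
formula, self-adjoint, compact), `P` is the isotypic projection of `χ` (a.e. `d4Project χ`, idempotent, self-adjoint,
commuting with `A`, fixing channel functions, with channel representatives on its range), `U₁` is the quarter turn
(a.e. composition with `rot`, commuting with `A` and `P`, isometric, skew on the `E` sector), and the deflated
Hilbert–Schmidt family bound holds on `P`-fixed orthonormal families, the deflation being a positive form. [folklore] -/
theorem kltp_channelOps (ε : Momentum → ℝ) (μ : ℝ) [IsFiniteMeasure (fermiCurveMeasure ε μ)]
    (hT : ∀ g : DihedralGroup 4, MeasurePreserving (d4Momentum g) (fermiCurveMeasure ε μ) (fermiCurveMeasure ε μ))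
    (hχHS : MemLp (fun z : Momentum × Momentum => lindhardFunction ε μ (z.1 + z.2)) 2
      ((fermiCurveMeasure ε μ).prod (fermiCurveMeasure ε μ)))
    (hLD4 : ∀ (g : DihedralGroup 4) (q : Momentum), lindhardFunction ε μ (d4Momentum g q) = lindhardFunction ε μ q) :
    ∀ (χ : D4Irrep) (withU : Bool) (M : ℕ) (c : Fin M → ℝ)
    (u : Fin M → Momentum → ℝ) (hu : ∀ m, MemLp (u m) 2 (fermiCurveMeasure ε μ)),
    (withU = true → χ = D4Irrep.A1g) → (∀ m, 0 ≤ c m) →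
    ∃ A P U₁ : Lp ℝ 2 (fermiCurveMeasure ε μ) →L[ℝ] Lp ℝ 2 (fermiCurveMeasure ε μ),
      (∀ φ : Lp ℝ 2 (fermiCurveMeasure ε μ),
        (A φ : Momentum → ℝ) =ᵐ[fermiCurveMeasure ε μ]
          fun k => ∫ k', ((if withU then 1 else 0) + lindhardFunction ε μ (k + k')) * φ k'
            ∂fermiCurveMeasure ε μ) ∧
      (∀ φ ψ : Lp ℝ 2 (fermiCurveMeasure ε μ),
        inner ℝ ψ (A φ) = ∫ k, ψ k * ∫ k', ((if withU then 1 else 0) +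
            lindhardFunction ε μ (k + k')) * φ k'
          ∂fermiCurveMeasure ε μ ∂fermiCurveMeasure ε μ) ∧
      IsSelfAdjoint A ∧ IsCompactOperator A ∧
      A * P = P * A ∧ P * P = P ∧ IsSelfAdjoint P ∧
      (∀ φ : Lp ℝ 2 (fermiCurveMeasure ε μ),
        (P φ : Momentum → ℝ) =ᵐ[fermiCurveMeasure ε μ] fun k => d4Project χ φ k) ∧
      (∀ (ψ : Momentum → ℝ) (hψ : MemLp ψ 2 (fermiCurveMeasure ε μ)),
        InChannel χ ψ → P (hψ.toLp ψ) = hψ.toLp ψ) ∧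
      (∀ φ : Lp ℝ 2 (fermiCurveMeasure ε μ), P φ = φ →
        ∃ ψ : Momentum → ℝ, InChannel χ ψ ∧ MemLp ψ 2 (fermiCurveMeasure ε μ) ∧
          (φ : Momentum → ℝ) =ᵐ[fermiCurveMeasure ε μ] ψ) ∧
      (∀ φ : Lp ℝ 2 (fermiCurveMeasure ε μ),
        (U₁ φ : Momentum → ℝ) =ᵐ[fermiCurveMeasure ε μ] fun k => φ (rotMomentum k)) ∧
      A * U₁ = U₁ * A ∧ P * U₁ = U₁ * P ∧
      (∀ φ ψ : Lp ℝ 2 (fermiCurveMeasure ε μ), inner ℝ (U₁ φ) (U₁ ψ) = inner ℝ φ ψ) ∧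
      (χ = D4Irrep.E → ∀ v : Lp ℝ 2 (fermiCurveMeasure ε μ), P v = v → inner ℝ v (U₁ v) = 0) ∧
      (∀ (m : ℕ) (f : Fin m → Lp ℝ 2 (fermiCurveMeasure ε μ)), Orthonormal ℝ f →
        (∀ j, P (f j) = f j) →
        ∑ j, ‖A (f j) - (∑ m, c m • (innerSL ℝ ((hu m).toLp (u m))).smulRight ((hu m).toLp (u m))) (f j)‖ ^ 2 ≤
          ∫ z, (d4Project χ (fun q => (if withU then 1 else 0) + lindhardFunction ε μ (z.1 + q)) z.2 -
              ∑ m, c m * (u m z.1 * u m z.2)) ^ 2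
            ∂(fermiCurveMeasure ε μ).prod (fermiCurveMeasure ε μ)) ∧
      (∀ φ : Lp ℝ 2 (fermiCurveMeasure ε μ),
        0 ≤ inner ℝ φ ((∑ m, c m • (innerSL ℝ ((hu m).toLp (u m))).smulRight ((hu m).toLp (u m))) φ)) := by
  intro χ withU M c u hu hU hc
  -- the base kernel and its operator
  set cU : ℝ := if withU then 1 else 0 with hcU
  have hκ2 := kltp_baseKernel_memLp ε μ hχHS cU
  obtain ⟨⟨A, hA⟩, hAprops⟩ :=
    Literature.Analysis.OperatorTheory.exists_l2KernelOp_package (K := fun k q : Momentum => cU + lindhardFunction ε μ (k + q)) hκ2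
  obtain ⟨hAc, hAsa', hHS, hAinner⟩ := hAprops A hA
  have hAsa : IsSelfAdjoint A := hAsa' fun k q => by rw [add_comm k q]
  -- the composition operators and the projection
  obtain ⟨U, hUae, hUmem, hU1, hUmul, hUinner, hUadj, hUcomm⟩ := kltp_d4Unitary ε μ hT
  have hAU : ∀ g : DihedralGroup 4, A * U g = U g * A :=
    hUcomm (fun k q : Momentum => cU + lindhardFunction ε μ (k + q)) A
      (fun g k q => kltp_baseKernel_invariant ε μ hLD4 cU g k q) hκ2 hA
  obtain ⟨P, hPdef, hPae, hPP, hPsa, hPU, hPfix, hPrepr, hPE⟩ := kltp_sectorProj ε μ hT U hUae hU1 hUmul hUadj χ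
  have hAP : A * P = P * A := by
    rw [hPdef, mul_smul_comm, smul_mul_assoc, Finset.mul_sum, Finset.sum_mul]
    congr 1
    refine Finset.sum_congr rfl fun g _ => ?_
    rw [mul_smul_comm, smul_mul_assoc, hAU g]
  -- the deflated sector kernel (abstract helper of …SectorKernel, with the base kernel in place of `χ₀`)
  have hproj : ∀ (ψ : Momentum → ℝ) (k : Momentum),
      d4Project χ ψ k = (χ.dim / 8 : ℝ) * ∑ g, χ.char g * ψ (d4Momentum g k) := fun _ _ => rfl
  have hK'2 := kl_sk_kernel_memLp hT hproj hκ2 c hu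
  have hK'ae := fun φ => kl_sk_kernel_ae hT kl_du_d4Momentum_mul d4Momentum_one (kl_sp_char_inv χ) hproj hκ2 hA hPae c hu φ
  have hHS' := (Literature.Analysis.OperatorTheory.exists_l2KernelOp_package hK'2).2 _ hK'ae
  refine ⟨A, P, U (DihedralGroup.r 1), hA, hAinner, hAsa, hAc, hAP, hPP, hPsa, hPae, hPfix, hPrepr,
    fun φ => hUae (DihedralGroup.r 1) φ, hAU _, (hPU _).symm, hUinner _, ?_, ?_,
    fun φ => kl_sk_finiteRank_nonneg hc _ φ⟩
  · intro hE v hv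
    exact kl_co_inner_rot_eq_zero U hUmul hUinner (hPE hE) hv
  · intro m f hf hfix
    have h1 := hHS'.2.2.1 m f hf
    refine le_of_eq_of_le (Finset.sum_congr rfl fun j _ => ?_) h1
    rw [sub_apply, mul_apply_eq_comp]
    change _ = ‖A (P (f j)) - _‖ ^ 2
    rw [hfix j]


/-- generic `stub_klFrameHS` (split of the pairing form + HS bound) from the bundled hypotheses. [folklore] -/
theorem kltp_frameHS (ε : Momentum → ℝ) (μ : ℝ) (hμ : KLTPAnalytic ε μ) (U : ℝ) (ψ : Momentum → ℝ)
    (hψ : MemLp ψ 2 (fermiCurveMeasure ε μ)) :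
    pairingForm ε μ U ψ =
        U * (∫ k, ψ k ∂fermiCurveMeasure ε μ) ^ 2 +
        U ^ 2 * ∫ k, ψ k * ∫ k', lindhardFunction ε μ (k + k') * ψ k'
          ∂fermiCurveMeasure ε μ ∂fermiCurveMeasure ε μ ∧
    |∫ k, ψ k * ∫ k', lindhardFunction ε μ (k + k') * ψ k'
          ∂fermiCurveMeasure ε μ ∂fermiCurveMeasure ε μ| ≤
      (∫ k, ψ k ^ 2 ∂fermiCurveMeasure ε μ) *
        Real.sqrt (∫ z, (lindhardFunction ε μ (z.1 + z.2)) ^ 2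
          ∂(fermiCurveMeasure ε μ).prod (fermiCurveMeasure ε μ)) := by
  haveI := hμ.1
  exact ⟨klhs_frame_pairingForm_split U hμ.2.2.1 hψ, abs_integral_mul_integral_mul_le hψ hμ.2.2.1⟩

end Summit.HubbardSuperconductivity.HubbardSuperconductivity.Theorems

end
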